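import Literature.Computability.Complexity.FKPointLocationUntyped
import HarnessLib

/-!
# Fournier–Koiran point location: the size of the queried forms along any run

Topic `Literature/Computability/Complexity`, grouping namespace `FKPointLocation`. A syntactic size
invariant of the TYPED states of the location protocol (`FKPointLocationProtocol.lean`) along ANY run
of its transition `upd` (whatever the answer bits): recorded apexes and the current apex below `2^K`,
binary-search accumulator below `2^K`, exit signs `±1`, at most `t` level records — `K` and `t`
growing by one per step (`Bnd`, `bnd_upd`, `bnd_runFrom`); and explicit bounds `|coefficient| ≤ 2^F`
on the level-local forms (`formBnd_localForm`), on a lifted form (`formBnd_liftForm`: one lift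
through an apex adds `2K + D + 2` to the exponent) and on the queried form (`formBnd_queryForm`).
This is the report's §2.2 ("all these coefficients have polynomial size") for the non-uniform
decision tree of `FKPointLocationTree.lean`, where — unlike for the uniform machine, whose query
length is bounded by its running time — the bound has to be proved by hand.

## References

* H. Fournier, P. Koiran, *Lower bounds are not easier over the reals: inside PH*, ICALP 2000,
  LNCS 1853 = LIP RR-1999-21, §2.2 (Lemma 3, Cor. 2: polynomial size of the coefficients of all
  tests, additive growth per level of the recursion). [FournierKoiran2000]
-/

namespace Literature.Computability.Complexity

namespace FKPointLocation

open Finset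

/-! ### Bounded apexes, the state invariant -/

section Invariant

variable {D : ℕ}

/-- An apex `(N, d)` with `|N_k| < 2^K` and `d < 2^K`. [cite: FournierKoiran2000, §2.2] -/
def ApexSmall (K : ℕ) (ap : (Fin D → ℤ) × ℕ) : Prop := (∀ k, (ap.1 k).natAbs < 2 ^ K) ∧ ap.2 < 2 ^ K

/-- Monotonicity of `ApexSmall` in the exponent. [folklore] -/
theorem ApexSmall.mono {K K' : ℕ} {ap : (Fin D → ℤ) × ℕ} (h : ApexSmall K ap) (hK : K ≤ K') : ApexSmall K' ap :=
  ⟨fun k => lt_of_lt_of_le (h.1 k) (Nat.pow_le_pow_right (by norm_num) hK),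
    lt_of_lt_of_le h.2 (Nat.pow_le_pow_right (by norm_num) hK)⟩

/-- The origin apex `(0, 1)` is bounded (`K ≥ 1`). [folklore] -/
theorem apexSmall_origin {K : ℕ} (hK : 1 ≤ K) : ApexSmall K ((0 : Fin D → ℤ), 1) :=
  ⟨fun _ => by simp, lt_of_lt_of_le (by norm_num) (Nat.pow_le_pow_right (by norm_num) hK : 2 ^ 1 ≤ 2 ^ K)⟩

/-- Any chunk decodes below `2^{|c|}` (private copy of `FKPointLocationSizes.natAbs_chunkInt_lt_length`,
to keep the imports of this file light). [folklore] -/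
private theorem natAbs_chunkInt_lt_length' (c : List Bool) : (chunkInt c).natAbs < 2 ^ c.length := by
  by_cases hc : c = []
  · subst hc; simp [chunkInt]
  · exact lt_of_lt_of_le (natAbs_chunkInt_lt c hc) (Nat.pow_le_pow_right (by norm_num) (Nat.sub_le _ _))

/-- A decoded apex is bounded by `2^{W+1}`, whatever the word. [folklore] -/
theorem apexSmall_decodeApex (W D : ℕ) (w : List Bool) : ApexSmall (W + 1) (decodeApex W D w) := by
  refine ⟨fun k => ?_, ?_⟩
  · simp only [decodeApex]
    refine lt_of_lt_of_le (natAbs_chunkInt_lt_length' _) (Nat.pow_le_pow_right (by norm_num) ?_)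
    exact List.length_take_le _ _
  · simp only [decodeApex]
    refine lt_of_lt_of_le (bitsToNat_lt _) (Nat.pow_le_pow_right (by norm_num) ?_)
    exact (List.length_take_le _ _).trans (Nat.le_succ W)

variable {Q : LevelParams}

/-- **The size invariant of a state**: at most `t` level records, all recorded apexes and the
current apex bounded by `2^K`, exit signs `±1`, binary-search accumulator below `2^K`.
[cite: FournierKoiran2000, §2.2] -/
structure Bnd (K t : ℕ) (dat : Data Q.D) : Prop where
  /-- at most `t` level records -/
  len : dat.levels.length ≤ t
  /-- recorded apexes are bounded -/
  apex : ∀ r ∈ dat.levels, ApexSmall K r.apex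
  /-- exit signs are `±1` -/
  eps : ∀ r ∈ dat.levels, r.εstar = 1 ∨ r.εstar = -1
  /-- the current apex is bounded -/
  capex : ApexSmall K dat.cur.apex
  /-- the binary-search accumulator is bounded -/
  acc : dat.cur.bsAcc < 2 ^ K

/-- Monotonicity of the invariant. [folklore] -/
theorem Bnd.mono {K K' t t' : ℕ} {dat : Data Q.D} (h : Bnd K t dat) (hK : K ≤ K') (ht : t ≤ t') : Bnd K' t' dat :=
  ⟨h.len.trans ht, fun r hr => (h.apex r hr).mono hK, h.eps, h.capex.mono hK,
    lt_of_lt_of_le h.acc (Nat.pow_le_pow_right (by norm_num) hK)⟩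

/-- Changing the scratch data to one with bounded apex and accumulator keeps the invariant (one step
later, one bit more). [folklore] -/
theorem Bnd.with_cur {K t : ℕ} {dat : Data Q.D} (h : Bnd K t dat) (c : Scratch Q.D)
    (hc1 : ApexSmall (K + 1) c.apex) (hc2 : c.bsAcc < 2 ^ (K + 1)) : Bnd (K + 1) (t + 1) { dat with cur := c } :=
  ⟨h.len.trans (Nat.le_succ t), fun r hr => (h.apex r hr).mono (Nat.le_succ K), h.eps, hc1, hc2⟩

/-- The same scratch apex and accumulator, one step later. [folklore] -/
theorem Bnd.with_cur' {K t : ℕ} {dat : Data Q.D} (h : Bnd K t dat) (c : Scratch Q.D)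
    (hc1 : c.apex = dat.cur.apex) (hc2 : c.bsAcc = dat.cur.bsAcc) : Bnd (K + 1) (t + 1) { dat with cur := c } :=
  h.with_cur c (hc1 ▸ h.capex.mono (Nat.le_succ K))
    (hc2 ▸ lt_of_lt_of_le h.acc (Nat.pow_le_pow_right (by norm_num) (Nat.le_succ K)))

/-- The initial state satisfies the invariant (`K ≥ 1`). [folklore] -/
theorem bnd_init {K : ℕ} (hK : 1 ≤ K) (t : ℕ) : Bnd K t (Data.init Q.D) :=
  ⟨by simp [Data.init], fun r hr => by simp [Data.init] at hr, fun r hr => by simp [Data.init] at hr,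
    by simpa [Data.init, Scratch.init] using (apexSmall_origin hK : ApexSmall K ((0 : Fin Q.D → ℤ), 1)),
    by simp [Data.init, Scratch.init]⟩

/-- Closing a level keeps the invariant. [folklore] -/
theorem bnd_finishLevel {K t : ℕ} {dat : Data Q.D} (h : Bnd K t dat) : Bnd (K + 1) (t + 1) (finishLevel Q dat) := by
  have hinit : ApexSmall (K + 1) (Scratch.init Q.D).apex ∧ (Scratch.init Q.D).bsAcc < 2 ^ (K + 1) :=
    ⟨by simpa [Scratch.init] using (apexSmall_origin (Nat.succ_pos K) : ApexSmall (K + 1) ((0 : Fin Q.D → ℤ), 1)),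
      by simp [Scratch.init]⟩
  have hapex : ∀ r₀ : LevelRec Q.D, r₀.apex = dat.cur.apex → ∀ r ∈ r₀ :: dat.levels, ApexSmall (K + 1) r.apex :=
      fun r₀ hr₀ r hr => by
    rcases List.mem_cons.1 hr with rfl | hr
    · exact hr₀ ▸ h.capex.mono (Nat.le_succ K)
    · exact (h.apex r hr).mono (Nat.le_succ K)
  have heps : ∀ r₀ : LevelRec Q.D, (r₀.εstar = 1 ∨ r₀.εstar = -1) →
      ∀ r ∈ r₀ :: dat.levels, r.εstar = 1 ∨ r.εstar = -1 := fun r₀ hr₀ r hr => by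
    rcases List.mem_cons.1 hr with rfl | hr
    · exact hr₀
    · exact h.eps r hr
  unfold finishLevel
  cases hc : dat.cur.cand with
  | none => exact ⟨by simpa using h.len, hapex _ rfl, heps _ (Or.inl rfl), hinit.1, hinit.2⟩
  | some c =>
    exact ⟨by simpa using h.len, hapex _ rfl, heps _ (by simp only [closeRec]; split_ifs <;> simp), hinit.1, hinit.2⟩

/-- **Preservation**: one transition keeps the invariant, with `K` and `t` increased by one, for
every task and every answer bit (`K > W`, so that decoded apexes fit). [cite: FournierKoiran2000, §2.2] -/
theorem bnd_upd {K t : ℕ} {dat : Data Q.D} (h : Bnd K t dat) (hK : Q.W + 1 ≤ K) (τ : Task Q.D) (b : Bool) :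
    Bnd (K + 1) (t + 1) (upd Q dat τ b) := by
  have hmono : Bnd (K + 1) (t + 1) dat := h.mono (Nat.le_succ K) (Nat.le_succ t)
  have h2K : dat.cur.bsAcc < 2 ^ K := h.acc
  have hpow : 2 ^ (K + 1) = 2 * 2 ^ K := by ring
  unfold upd
  by_cases hd : dat.done
  · simpa [hd] using hmono
  rw [if_neg hd]
  cases τ with
  | bs i k =>
    dsimp only
    have hb : b.toNat ≤ 1 := Bool.toNat_le b
    split_ifs <;> first
      | exact hmono
      | (refine h.with_cur _ (h.capex.mono (Nat.le_succ K)) ?_; dsimp only; omega)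
  | ex sc m => refine h.with_cur' _ ?_ ?_ <;> rfl
  | pf sc m w =>
    dsimp only
    split_ifs <;> first
      | exact hmono
      | (refine h.with_cur' _ ?_ ?_ <;> rfl)
  | st sc => refine h.with_cur' _ ?_ ?_ <;> rfl
  | ap w =>
    dsimp only
    split_ifs
    · refine h.with_cur _ ((apexSmall_decodeApex Q.W Q.D _).mono (by omega)) ?_
      show dat.cur.bsAcc < 2 ^ (K + 1)
      omega
    · refine h.with_cur' _ ?_ ?_ <;> rfl
  | eqGe i => refine h.with_cur' _ ?_ ?_ <;> rfl
  | eqLe i => refine h.with_cur' _ ?_ ?_ <;> rfl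
  | fa i => refine h.with_cur' _ ?_ ?_ <;> rfl
  | close => exact bnd_finishLevel h
  | fin => exact ⟨hmono.len, hmono.apex, hmono.eps, hmono.capex, hmono.acc⟩

/-- The invariant along a truthful run of a list of tasks. [cite: FournierKoiran2000, §2.2] -/
theorem bnd_runFrom {finT : Cert Q.D → Prop} {xh : Fin Q.D → ℝ} {K : ℕ} (hK : Q.W + 1 ≤ K) :
    ∀ (ts : List (Task Q.D)) (t : ℕ) (dat : Data Q.D), Bnd K t dat →
      Bnd (K + ts.length) (t + ts.length) (runFrom Q finT xh dat ts)
  | [], t, dat, h => by simpa using h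
  | τ :: ts, t, dat, h => by
    rw [runFrom_cons]
    have h1 : Bnd (K + 1) (t + 1) (step Q finT xh dat τ) := bnd_upd h hK τ _
    have := bnd_runFrom (finT := finT) (xh := xh) (K := K + 1) (by omega) ts (t + 1) _ h1
    exact this.mono (by simp; omega) (by simp; omega)

end Invariant

/-! ### Bounded forms -/

section Forms

variable {D : ℕ}

/-- A form with all coefficients and the constant at most `2^F` in absolute value. [cite: FournierKoiran2000, §2.2] -/
def FormBnd (F : ℕ) (φ : AffForm D) : Prop := (∀ k, (φ.1 k).natAbs ≤ 2 ^ F) ∧ φ.2.natAbs ≤ 2 ^ F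

/-- Monotonicity of `FormBnd`. [folklore] -/
theorem FormBnd.mono {F F' : ℕ} {φ : AffForm D} (h : FormBnd F φ) (hF : F ≤ F') : FormBnd F' φ :=
  ⟨fun k => (h.1 k).trans (Nat.pow_le_pow_right (by norm_num) hF), h.2.trans (Nat.pow_le_pow_right (by norm_num) hF)⟩

/-- The zero form is bounded. [folklore] -/
theorem formBnd_zero (F : ℕ) : FormBnd F ((0, 0) : AffForm D) := ⟨fun _ => by simp, by simp⟩

/-- `|signOf| ≤ 1`. [folklore] -/
theorem natAbs_signOf_le (g l : Bool) : (signOf g l).natAbs ≤ 1 := by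
  unfold signOf; split_ifs <;> simp

/-- `|sign z| ≤ 1`. [folklore] -/
theorem natAbs_sign_le (z : ℤ) : z.sign.natAbs ≤ 1 := by
  rcases lt_trichotomy z 0 with h | h | h <;>
    simp [Int.sign_eq_neg_one_of_neg, Int.sign_eq_one_of_pos, h]

/-- A sum of `D` bounded products is bounded. [folklore] -/
theorem natAbs_sum_mul_le {a σ : Fin D → ℤ} {G M : ℕ} (ha : ∀ k, (a k).natAbs ≤ G) (hσ : ∀ k, (σ k).natAbs ≤ M) :
    (∑ k, a k * σ k).natAbs ≤ D * (G * M) := by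
  calc (∑ k, a k * σ k).natAbs ≤ ∑ k, (a k * σ k).natAbs := Int.natAbs_sum_le _ _
    _ ≤ ∑ _k : Fin D, G * M := sum_le_sum fun k _ => by
        rw [Int.natAbs_mul]; exact Nat.mul_le_mul (ha k) (hσ k)
    _ = D * (G * M) := by simp

/-- `D + 3 ≤ 2^{D+2}` and `3D + 1 ≤ 2^{D+2}`. [folklore] -/
theorem small_le_two_pow (D : ℕ) : D + 3 ≤ 2 ^ (D + 2) ∧ 3 * D + 1 ≤ 2 ^ (D + 2) := by
  have h := (Nat.lt_two_pow_self : D < 2 ^ D)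
  have : 2 ^ (D + 2) = 4 * 2 ^ D := by ring
  constructor <;> omega

/-- **One lift through a bounded apex** adds `2K + D + 2` to the size exponent.
[cite: FournierKoiran2000, §2.2 (Lemma 3: the size of `Aff(s, h')`)] -/
theorem formBnd_liftForm {F K : ℕ} {φ : AffForm D} (hφ : FormBnd F φ) (A : ApexRec D)
    (hσ : ∀ k, (A.σ k).natAbs < 2 ^ K) (hd : A.d < 2 ^ K) (hε : A.ε = 1 ∨ A.ε = -1) :
    FormBnd (F + 2 * K + D + 2) (liftForm A φ) := by
  -- abbreviations and elementary bounds
  set G : ℕ := 2 ^ F with hG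
  set M : ℕ := 2 ^ K with hM
  have hσ' : ∀ k, (A.σ k).natAbs ≤ M := fun k => (hσ k).le
  have hd' : (A.d : ℤ).natAbs ≤ M := by rw [Int.natAbs_natCast]; exact hd.le
  have hε' : A.ε.natAbs ≤ 1 := by rcases hε with h | h <;> simp [h]
  have hS : (∑ k, φ.1 k * A.σ k).natAbs ≤ D * (G * M) := natAbs_sum_mul_le hφ.1 hσ'
  have hAσ : ((∑ k, φ.1 k * A.σ k) + φ.2 * A.d).natAbs ≤ (D + 1) * (G * M) := by
    calc _ ≤ (∑ k, φ.1 k * A.σ k).natAbs + (φ.2 * (A.d : ℤ)).natAbs := Int.natAbs_add_le _ _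
      _ ≤ D * (G * M) + G * M := by
          rw [Int.natAbs_mul]; exact Nat.add_le_add hS (Nat.mul_le_mul hφ.2 hd')
      _ = (D + 1) * (G * M) := by ring
  have hE : (A.ε * A.d - A.σ A.i₀).natAbs ≤ 2 * M := by
    calc _ ≤ (A.ε * (A.d : ℤ)).natAbs + (A.σ A.i₀).natAbs := Int.natAbs_sub_le _ _
      _ ≤ 1 * M + M := by rw [Int.natAbs_mul]; exact Nat.add_le_add (Nat.mul_le_mul hε' hd') (hσ' _)
      _ = 2 * M := by ring
  have hτ := natAbs_sign_le (A.ε * A.d - A.σ A.i₀)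
  have htarget : 2 ^ (F + 2 * K + D + 2) = G * M * M * 2 ^ (D + 2) := by
    simp only [hG, hM, ← pow_add]; ring_nf
  obtain ⟨hD1, hD2⟩ := small_le_two_pow D
  refine ⟨fun k => ?_, ?_⟩
  · -- coefficient `τ (E d a_k + [k = i₀] Aσ d)`
    show (((A.ε * A.d - A.σ A.i₀).sign) * ((A.ε * A.d - A.σ A.i₀) * A.d * φ.1 k +
      if k = A.i₀ then ((∑ k, φ.1 k * A.σ k) + φ.2 * A.d) * A.d else 0)).natAbs ≤ 2 ^ (F + 2 * K + D + 2)
    rw [htarget, Int.natAbs_mul]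
    have hite : (if k = A.i₀ then ((∑ k, φ.1 k * A.σ k) + φ.2 * A.d) * (A.d : ℤ) else 0).natAbs ≤ (D + 1) * (G * M) * M := by
      split_ifs
      · rw [Int.natAbs_mul]; exact Nat.mul_le_mul hAσ hd'
      · simp
    have h1 : ((A.ε * A.d - A.σ A.i₀) * A.d * φ.1 k).natAbs ≤ 2 * M * M * G := by
      rw [Int.natAbs_mul, Int.natAbs_mul]; exact Nat.mul_le_mul (Nat.mul_le_mul hE hd') (hφ.1 k)
    calc _ ≤ 1 * (2 * M * M * G + (D + 1) * (G * M) * M) :=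
          Nat.mul_le_mul hτ ((Int.natAbs_add_le _ _).trans (Nat.add_le_add h1 hite))
      _ = G * M * M * (D + 3) := by ring
      _ ≤ G * M * M * 2 ^ (D + 2) := Nat.mul_le_mul_left _ hD1
  · -- constant `τ (-(Aσ σ_{i₀}) - E (a·σ))`
    show (((A.ε * A.d - A.σ A.i₀).sign) * (-(((∑ k, φ.1 k * A.σ k) + φ.2 * A.d) * A.σ A.i₀) -
      (A.ε * A.d - A.σ A.i₀) * ∑ k, φ.1 k * A.σ k)).natAbs ≤ 2 ^ (F + 2 * K + D + 2)
    rw [htarget, Int.natAbs_mul]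
    have h1 : (-(((∑ k, φ.1 k * A.σ k) + φ.2 * A.d) * A.σ A.i₀)).natAbs ≤ (D + 1) * (G * M) * M := by
      rw [Int.natAbs_neg, Int.natAbs_mul]; exact Nat.mul_le_mul hAσ (hσ' _)
    have h2 : ((A.ε * A.d - A.σ A.i₀) * ∑ k, φ.1 k * A.σ k).natAbs ≤ 2 * M * (D * (G * M)) := by
      rw [Int.natAbs_mul]; exact Nat.mul_le_mul hE hS
    calc _ ≤ 1 * ((D + 1) * (G * M) * M + 2 * M * (D * (G * M))) :=
          Nat.mul_le_mul hτ ((Int.natAbs_sub_le _ _).trans (Nat.add_le_add h1 h2))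
      _ = G * M * M * (3 * D + 1) := by ring
      _ ≤ G * M * M * 2 ^ (D + 2) := Nat.mul_le_mul_left _ hD2

/-- **Iterated lifts**: through a history of `h` bounded apexes the exponent grows by `h (2K + D + 2)`.
[cite: FournierKoiran2000, §2.2 (Cor. 2: additive growth per level)] -/
theorem formBnd_liftAll {K : ℕ} :
    ∀ (hist : List (ApexRec D)) {F : ℕ} {φ : AffForm D}, FormBnd F φ →
      (∀ A ∈ hist, (∀ k, (A.σ k).natAbs < 2 ^ K) ∧ A.d < 2 ^ K ∧ (A.ε = 1 ∨ A.ε = -1)) →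
        FormBnd (F + hist.length * (2 * K + D + 2)) (liftAll hist φ)
  | [], F, φ, hφ, _ => by simpa [liftAll] using hφ
  | A :: hist, F, φ, hφ, hA => by
    rw [liftAll_cons]
    have h1 := hA A (by simp)
    have h2 := formBnd_liftForm hφ A h1.1 h1.2.1 h1.2.2
    have h3 := formBnd_liftAll hist h2 (fun A' hA' => hA A' (by simp [hA']))
    refine h3.mono (le_of_eq ?_)
    simp only [List.length_cons]
    ring

variable {Q : LevelParams}

/-- Binary-search tasks of the typed schedule are within the depth `L`. [folklore] -/
theorem bs_round_le_of_mem_agenda {i : Fin Q.D} {k : ℕ} (h : Task.bs i k ∈ agenda Q) : k ≤ Q.L :=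
  kLe_of_mem_uagenda Q.toU (toU_mem_uagenda Q h)

/-- **Level-local forms are small**: exponent `2K + L + 3` in a state satisfying `Bnd K t`.
[cite: FournierKoiran2000, §2.2] -/
theorem formBnd_localForm {K t : ℕ} {dat : Data Q.D} (h : Bnd K t dat) {τ : Task Q.D} (hτ : τ ∈ agenda Q) :
    FormBnd (2 * K + Q.L + 3) (localForm dat τ) := by
  have hM := h.capex
  have hpow1 : 2 ^ (2 * K + Q.L + 3) = 2 ^ Q.L * 2 ^ K * 2 ^ K * 8 := by
    rw [show 2 * K + Q.L + 3 = Q.L + K + K + 3 by ring, pow_add, pow_add, pow_add]; norm_num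
  have ⟨hK1, hL1⟩ : 1 ≤ 2 ^ K ∧ 1 ≤ 2 ^ Q.L := ⟨Nat.one_le_two_pow, Nat.one_le_two_pow⟩
  cases τ with
  | bs i k =>
    have hk : 2 ^ k ≤ 2 ^ Q.L := Nat.pow_le_pow_right (by norm_num) (bs_round_le_of_mem_agenda hτ)
    have hacc : (if k = 0 then 0 else dat.cur.bsAcc) < 2 ^ K := by split_ifs <;> [exact Nat.two_pow_pos K; exact h.acc]
    refine ⟨fun i' => ?_, ?_⟩
    · show (if i' = i then (2 : ℤ) ^ k else 0).natAbs ≤ _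
      split_ifs
      · rw [Int.natAbs_pow, hpow1]; simp only [Int.reduceAbs]; nlinarith [Nat.mul_le_mul hK1 hK1]
      · simp
    · show ((2 : ℤ) ^ k - 2 * ((if k = 0 then 0 else dat.cur.bsAcc : ℕ) : ℤ) - 1).natAbs ≤ _
      set acc := (if k = 0 then 0 else dat.cur.bsAcc) with hacc_def
      have e1 : ((2 : ℤ) ^ k) = ((2 ^ k : ℕ) : ℤ) := by push_cast; rfl
      rw [e1, hpow1]
      have : 2 ^ k + 2 * acc + 1 ≤ 2 ^ Q.L * 2 ^ K * 2 ^ K * 8 := by nlinarith [Nat.mul_le_mul hK1 hK1, Nat.mul_le_mul hL1 hK1]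
      generalize 2 ^ Q.L * 2 ^ K * 2 ^ K * 8 = N at this ⊢
      generalize 2 ^ k = p at this ⊢
      omega
  | eqGe i =>
    refine ⟨fun i' => ?_, ?_⟩
    · show (if i' = i then (dat.cur.apex.2 : ℤ) else 0).natAbs ≤ _
      split_ifs
      · rw [Int.natAbs_natCast, hpow1]; nlinarith [hM.2, Nat.mul_le_mul hL1 hK1]
      · simp
    · show (-dat.cur.apex.1 i).natAbs ≤ _
      rw [Int.natAbs_neg, hpow1]; nlinarith [hM.1 i, Nat.mul_le_mul hL1 hK1]
  | eqLe i =>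
    refine ⟨fun i' => ?_, ?_⟩
    · show (if i' = i then -(dat.cur.apex.2 : ℤ) else 0).natAbs ≤ _
      split_ifs
      · rw [Int.natAbs_neg, Int.natAbs_natCast, hpow1]; nlinarith [hM.2, Nat.mul_le_mul hL1 hK1]
      · simp
    · show (dat.cur.apex.1 i).natAbs ≤ _
      rw [hpow1]; nlinarith [hM.1 i, Nat.mul_le_mul hL1 hK1]
  | fa i =>
    simp only [localForm]
    cases hc : dat.cur.cand with
    | none => exact formBnd_zero _
    | some c =>
      simp only
      -- the facet comparison form
      set εc := signOf (dat.cur.ge c) (dat.cur.le c)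
      set εi := signOf (dat.cur.ge i) (dat.cur.le i)
      set d : ℤ := (dat.cur.apex.2 : ℤ)
      have hεc : εc.natAbs ≤ 1 := natAbs_signOf_le _ _
      have hεi : εi.natAbs ≤ 1 := natAbs_signOf_le _ _
      have hdM : d.natAbs ≤ 2 ^ K := by simp only [d, Int.natAbs_natCast]; exact hM.2.le
      have hν : ∀ (ε : ℤ) (j : Fin Q.D), ε.natAbs ≤ 1 → (d - ε * dat.cur.apex.1 j).natAbs ≤ 2 * 2 ^ K := by
        intro ε j hε
        calc _ ≤ d.natAbs + (ε * dat.cur.apex.1 j).natAbs := Int.natAbs_sub_le _ _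
          _ ≤ 2 ^ K + 1 * 2 ^ K := by rw [Int.natAbs_mul]; exact Nat.add_le_add hdM (Nat.mul_le_mul hε (hM.1 j).le)
          _ = 2 * 2 ^ K := by ring
      have hterm : ∀ (ε ε' : ℤ) (j : Fin Q.D) (z : ℤ), ε.natAbs ≤ 1 → ε'.natAbs ≤ 1 → z.natAbs ≤ 2 ^ K →
          ((d - ε * dat.cur.apex.1 j) * ε' * z).natAbs ≤ 2 * 2 ^ K * 2 ^ K := by
        intro ε ε' j z hε hε' hz
        rw [Int.natAbs_mul, Int.natAbs_mul]
        calc _ ≤ 2 * 2 ^ K * 1 * 2 ^ K := Nat.mul_le_mul (Nat.mul_le_mul (hν ε j hε) hε') hz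
          _ = _ := by ring
      refine ⟨fun i' => ?_, ?_⟩
      · show ((if i' = c then (d - εi * dat.cur.apex.1 i) * εc * d else 0) +
            (if i' = i then -((d - εc * dat.cur.apex.1 c) * εi * d) else 0)).natAbs ≤ _
        have h1 : (if i' = c then (d - εi * dat.cur.apex.1 i) * εc * d else 0).natAbs ≤ 2 * 2 ^ K * 2 ^ K := by
          split_ifs
          · exact hterm _ _ _ _ hεi hεc hdM
          · simp
        have h2 : (if i' = i then -((d - εc * dat.cur.apex.1 c) * εi * d) else 0).natAbs ≤ 2 * 2 ^ K * 2 ^ K := by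
          split_ifs
          · rw [Int.natAbs_neg]; exact hterm _ _ _ _ hεc hεi hdM
          · simp
        calc _ ≤ 2 * 2 ^ K * 2 ^ K + 2 * 2 ^ K * 2 ^ K := (Int.natAbs_add_le _ _).trans (Nat.add_le_add h1 h2)
          _ ≤ _ := by rw [hpow1]; nlinarith [Nat.mul_le_mul hK1 hK1]
      · show (-((d - εi * dat.cur.apex.1 i) * εc * dat.cur.apex.1 c) +
            (d - εc * dat.cur.apex.1 c) * εi * dat.cur.apex.1 i).natAbs ≤ _
        have h1 : (-((d - εi * dat.cur.apex.1 i) * εc * dat.cur.apex.1 c)).natAbs ≤ 2 * 2 ^ K * 2 ^ K := by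
          rw [Int.natAbs_neg]; exact hterm _ _ _ _ hεi hεc (hM.1 c).le
        have h2 : ((d - εc * dat.cur.apex.1 c) * εi * dat.cur.apex.1 i).natAbs ≤ 2 * 2 ^ K * 2 ^ K :=
          hterm _ _ _ _ hεc hεi (hM.1 i).le
        calc _ ≤ 2 * 2 ^ K * 2 ^ K + 2 * 2 ^ K * 2 ^ K := (Int.natAbs_add_le _ _).trans (Nat.add_le_add h1 h2)
          _ ≤ _ := by rw [hpow1]; nlinarith [Nat.mul_le_mul hK1 hK1]
  | _ => exact formBnd_zero _

/-- **The queried form is small**: in a state with `Bnd K t`, the form of a task of the schedule has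
exponent at most `2K + L + 3 + t (2K + D + 2)`. [cite: FournierKoiran2000, §2.2 (Cor. 2)] -/
theorem formBnd_queryForm {K t : ℕ} {dat : Data Q.D} (h : Bnd K t dat) {τ : Task Q.D} (hτ : τ ∈ agenda Q) :
    FormBnd (2 * K + Q.L + 3 + t * (2 * K + Q.D + 2)) (queryForm dat τ) := by
  unfold queryForm
  have hhist : ∀ A ∈ dat.hist, (∀ k, (A.σ k).natAbs < 2 ^ K) ∧ A.d < 2 ^ K ∧ (A.ε = 1 ∨ A.ε = -1) := by
    intro A hA
    simp only [Data.hist, List.mem_map] at hA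
    obtain ⟨r, hr, rfl⟩ := hA
    exact ⟨(h.apex r hr).1, (h.apex r hr).2, h.eps r hr⟩
  have hlen : dat.hist.length ≤ t := by simpa [Data.hist] using h.len
  exact (formBnd_liftAll dat.hist (formBnd_localForm h hτ) hhist).mono
    (Nat.add_le_add_left (Nat.mul_le_mul_right _ hlen) _)

end Forms

end FKPointLocation

end Literature.Computability.Complexity
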